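import Mathlib
import Literature.Computability.AlgebraicComplexity.LinSubst
import Literature.Computability.AlgebraicComplexity.OrbitClosure
import Literature.Computability.AlgebraicComplexity.OrbitClosureProofs
import Literature.Computability.AlgebraicComplexity.BorderDcQuadraticBoundProofs
import Literature.Computability.AlgebraicComplexity.DeterminantalConormalBoundKernelAlgebra
import Summits.ValiantsHypothesis.ValiantsHypothesis.Theorems.BorderApolarityToricWitnessObstructionQPInitialDegeneration

/-!
# `per₃` is not a torus leading form of a `3 × 3` linear determinant (border `(3,3)` via LMR)

Route `ValiantsHypothesis/BorderApolarity`, crux `ToricWitnessObstructionQP`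
(stmt-ValiantsHypothesis-14753), line `Sketch`, lead c5 — seventh helper for the regime analysis of
torus leading forms of `per₃` below Grenet's size `7` (crux work note `regimes.md`, §3 step (i),
corank-`3` branch): if `M` is a `3 × 3` matrix of linear forms in the nine variables and the top
`w`-weight component of `c · det M` is `per₃`, then along the torus `s^w` the rescaled determinants
`s^{-e} · c · det M(s^w y)` are again `3 × 3` linear determinants (points of `End · det₃`, hence of
the orbit closure `Δ[det₃]`, tree `endOrbit_subset_orbitClosure_holds`) and converge
coefficientwise to `per₃`; so `per₃ ∈ Δ[det₃]`, contradicting Landsberg–Manivel–Ressayre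
(`LMR2013_thm_1_1_1_holds`: `3² ≤ 2·3` is false).

* `not_perPoly_three_eq_top_of_det_three`.
-/

open MvPolynomial Module Filter Topology
open scoped Polynomial

-- the mandated summit-side namespace repeats a component by design (single-problem summit)
set_option linter.dupNamespace false

namespace Summit.ValiantsHypothesis.ValiantsHypothesis.Theorems.BorderApolarityToricWitnessObstructionQP

noncomputable section

namespace Border33

open Literature.Computability.AlgebraicComplexity

variable {K : Type*} [Field K] {σ : Type*} [Fintype σ]

/-- A homogeneous linear form is the sum of its coefficients times the variables. [folklore] -/
theorem eq_sum_smul_X_of_isHomogeneous_one {f : MvPolynomial σ K} (hf : f.IsHomogeneous 1) :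
    f = ∑ a, coeff (Finsupp.single a 1) f • X a := by
  have h := DeterminantalConormal.eq_C_add_sum_of_totalDegree_le_one (p := f)
    (hf.totalDegree_le)
  have h0 : coeff 0 f = 0 := hf.coeff_eq_zero (by simp)
  rw [h0, C_0, zero_add] at h
  conv_lhs => rw [h]
  refine Finset.sum_congr rfl fun a _ => ?_
  rw [smul_eq_C_mul]

/-- **A square matrix of linear forms in the variables `σ × ... ` : its determinant is a linear
substitution of the generic determinant** (for the index type of the variables equal to the
matrix positions). [folklore] -/
theorem det_eq_linSubst_detPoly {n : Type*} [Fintype n] [DecidableEq n]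
    (M : Matrix n n (MvPolynomial (n × n) K)) (hM : ∀ i j, (M i j).IsHomogeneous 1) :
    M.det = linSubst (n × n) K (fun a p => coeff (Finsupp.single a 1) (M p.1 p.2)) (detPoly n K) := by
  unfold detPoly
  rw [show (linSubst (n × n) K (fun a p => coeff (Finsupp.single a 1) (M p.1 p.2))
      (Matrix.mvPolynomialX n n K).det) = ((linSubst (n × n) K
        (fun a p => coeff (Finsupp.single a 1) (M p.1 p.2)) : MvPolynomial (n × n) K →+* _).mapMatrix
        (Matrix.mvPolynomialX n n K)).det from RingHom.map_det _ _]
  congr 1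
  refine Matrix.ext fun i j => ?_
  rw [RingHom.mapMatrix_apply, Matrix.map_apply, Matrix.mvPolynomialX_apply, RingHom.coe_coe,
    linSubst_X]
  exact eq_sum_smul_X_of_isHomogeneous_one (hM i j)

/-- Euclidean limits of points of the orbit closure lie in the orbit closure. [folklore] -/
theorem mem_orbitClosure_of_tendsto_of_mem {ι : Type*} [Fintype ι] [DecidableEq ι]
    {f g : MvPolynomial ι ℂ} (Q : ℕ → MvPolynomial ι ℂ)
    (hQ : ∀ t, Q t ∈ orbitClosure f)
    (hlim : Tendsto (fun t => coeffVec (Q t)) atTop (𝓝 (coeffVec g))) :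
    g ∈ orbitClosure f := by
  rw [mem_orbitClosure_iff]
  intro p hp
  have hcont : Continuous fun x : (ι →₀ ℕ) → ℂ => eval x p := continuous_eval p
  have h1 : Tendsto (fun t => eval (coeffVec (Q t)) p) atTop (𝓝 (eval (coeffVec g) p)) :=
    (hcont.tendsto (coeffVec g)).comp hlim
  have hae : ∀ x : (ι →₀ ℕ) → ℂ, aeval x p = eval x p := fun x => by
    rw [aeval_def]
    rfl
  have h0 : ∀ t, eval (coeffVec (Q t)) p = 0 := fun t => by
    rw [← hae]
    exact (mem_orbitClosure_iff.1 (hQ t)) p hp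
  have h3 : Tendsto (fun _ : ℕ => (0 : ℂ)) atTop (𝓝 (eval (coeffVec g) p)) := h1.congr h0
  have h4 : eval (coeffVec g) p = 0 := tendsto_nhds_unique h3 tendsto_const_nhds
  rw [hae]
  exact h4

/-- `paddedPerPoly ℂ 3 3 = per₃`. [folklore] -/
theorem paddedPerPoly_three_three : paddedPerPoly ℂ 3 3 = perPoly (Fin 3) ℂ := by
  unfold paddedPerPoly
  have h0 : (X ((0 : Fin 3), (0 : Fin 3)) : MvPolynomial (Fin 3 × Fin 3) ℂ) ^ (3 - 3) = 1 := pow_zero _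
  rw [h0, one_mul]
  let e : BlockIdx 3 3 ≃ Fin 3 := Equiv.subtypeUnivEquiv fun i => by simp
  have hfun : (fun ij : BlockIdx 3 3 × BlockIdx 3 3 => ((ij.1 : Fin 3), (ij.2 : Fin 3))) =
      Prod.map e e := by
    funext ij
    rfl
  rw [hfun, rename_perPoly_equiv e]

/-- The diagonal substitution `X a ↦ s^{w a} X a` is `linSubst (diagonal)`. -/
theorem linSubst_diagonal_eq_aeval [DecidableEq σ] (d : σ → K) :
    (linSubst σ K (Matrix.diagonal d) : MvPolynomial σ K →ₐ[K] MvPolynomial σ K) =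
      aeval fun a => C (d a) * X a := by
  refine MvPolynomial.algHom_ext fun a => ?_
  rw [linSubst_X, aeval_X, Finset.sum_eq_single a]
  · rw [Matrix.diagonal_apply_eq, smul_eq_C_mul]
  · intro b _ hb
    rw [Matrix.diagonal_apply_ne _ hb, zero_smul]
  · intro h
    exact absurd (Finset.mem_univ a) h

/-- Torus scaling of the weight decomposition: `Q(s^w X) = Σ_j s^j Q_j`. [folklore] -/
theorem linSubst_diagonal_pow_eq_sum [DecidableEq σ] (w : σ → ℕ) (s : K) (Q : MvPolynomial σ K) (e : ℕ)
    (hwe : ∀ d ∈ Q.support, Finsupp.weight w d ≤ e) :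
    linSubst σ K (Matrix.diagonal fun a => s ^ w a) Q =
      ∑ j ∈ Finset.range (e + 1), C (s ^ j) * weightedHomogeneousComponent w j Q := by
  classical
  have hsum : ∑ j ∈ Finset.range (e + 1), weightedHomogeneousComponent w j Q = Q := by
    have h := sum_weightedHomogeneousComponent w Q
    rw [finsum_eq_sum_of_support_subset _ (s := Finset.range (e + 1))] at h
    · exact h
    · intro j hj
      rw [Function.mem_support] at hj
      rw [Finset.coe_range, Set.mem_Iio, Nat.lt_succ_iff]
      by_contra hje
      exact hj (weightedHomogeneousComponent_eq_zero' j Q fun d hd => by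
        have := hwe d hd; omega)
  conv_lhs => rw [← hsum]
  rw [map_sum]
  refine Finset.sum_congr rfl fun j _ => ?_
  rw [linSubst_diagonal_eq_aeval]
  have h := InitialDegeneration.aeval_pow_mul_of_isWeightedHomogeneous w
    (weightedHomogeneousComponent_isWeightedHomogeneous (w := w) j Q) (C s) X
  have hfun : (fun v => C s ^ w v * X v : σ → MvPolynomial σ K) = fun a => C (s ^ w a) * X a := by
    funext v; rw [C_pow]
  rw [hfun] at h
  rw [h, aeval_X_left_apply, C_pow]

/-- **`per₃` is not the torus leading form of (a constant times) a `3 × 3` linear determinant.**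
[cite: LandsbergManivelRessayre2013, Theorem 1.1.1] -/
theorem not_perPoly_three_eq_top_of_det_three (M : Matrix (Fin 3) (Fin 3) (MvPolynomial (Fin 3 × Fin 3) ℂ))
    (hM : ∀ i j, (M i j).IsHomogeneous 1) (c : ℂ) (w : Fin 3 × Fin 3 → ℕ) (e : ℕ)
    (hwe : ∀ d ∈ (C c * M.det).support, Finsupp.weight w d ≤ e)
    (htop : weightedHomogeneousComponent w e (C c * M.det) = perPoly (Fin 3) ℂ) : False := by
  classical
  set Q : MvPolynomial (Fin 3 × Fin 3) ℂ := C c * M.det with hQdef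
  -- `Q = det M'` with `M'` = `M` with row `0` scaled by `c`
  set M' : Matrix (Fin 3) (Fin 3) (MvPolynomial (Fin 3 × Fin 3) ℂ) :=
    M.updateRow 0 ((C c : MvPolynomial (Fin 3 × Fin 3) ℂ) • M 0) with hM'
  have hM'h : ∀ i j, (M' i j).IsHomogeneous 1 := by
    intro i j
    rw [hM']
    by_cases hi : i = 0
    · subst hi
      rw [Matrix.updateRow_self, Pi.smul_apply, smul_eq_mul]
      exact (hM 0 j).C_mul c
    · rw [Matrix.updateRow_ne hi]
      exact hM i j
  have hQdet : Q = M'.det := by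
    rw [hM', Matrix.det_updateRow_smul, Matrix.updateRow_eq_self]
  -- the rescaled determinants along the torus
  let D : ℂ → Matrix (Fin 3 × Fin 3) (Fin 3 × Fin 3) ℂ := fun s => Matrix.diagonal fun a => s ^ w a
  let Ms : ℂ → Matrix (Fin 3) (Fin 3) (MvPolynomial (Fin 3 × Fin 3) ℂ) := fun s =>
    (M'.map (linSubst _ ℂ (D s))).updateRow 0
      ((C ((s ^ e)⁻¹) : MvPolynomial (Fin 3 × Fin 3) ℂ) • (M'.map (linSubst _ ℂ (D s))) 0)
  have hMsh : ∀ s i j, (Ms s i j).IsHomogeneous 1 := by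
    intro s i j
    simp only [Ms]
    by_cases hi : i = 0
    · subst hi
      rw [Matrix.updateRow_self, Pi.smul_apply, smul_eq_mul, Matrix.map_apply]
      exact (linSubst_isHomogeneous _ (hM'h 0 j)).C_mul _
    · rw [Matrix.updateRow_ne hi, Matrix.map_apply]
      exact linSubst_isHomogeneous _ (hM'h i j)
  have hdetMs : ∀ s, (Ms s).det =
      ∑ j ∈ Finset.range (e + 1), C ((s ^ e)⁻¹ * s ^ j) * weightedHomogeneousComponent w j Q := by
    intro s
    simp only [Ms]
    rw [Matrix.det_updateRow_smul, Matrix.updateRow_eq_self]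
    have hmap : (M'.map (linSubst _ ℂ (D s))).det = linSubst _ ℂ (D s) M'.det := by
      rw [show M'.map ⇑(linSubst (Fin 3 × Fin 3) ℂ (D s)) =
        (linSubst (Fin 3 × Fin 3) ℂ (D s) : MvPolynomial _ ℂ →+* _).mapMatrix M' from rfl,
        ← RingHom.map_det]
      rfl
    rw [hmap, ← hQdet, linSubst_diagonal_pow_eq_sum w s Q e hwe, Finset.mul_sum]
    refine Finset.sum_congr rfl fun j _ => ?_
    rw [← mul_assoc, ← map_mul]
  -- each rescaled determinant lies in the orbit closure of `det₃`
  have hmem : ∀ s, (Ms s).det ∈ orbitClosure (detPoly (Fin 3) ℂ) := by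
    intro s
    refine endOrbit_subset_orbitClosure_holds _ ?_
    exact ⟨_, (det_eq_linSubst_detPoly (Ms s) (hMsh s)).symm⟩
  -- along `s = t + 1 → ∞` they converge coefficientwise to `per₃ = Q_e`
  have hlim : Tendsto (fun t : ℕ => coeffVec ((Ms ((t : ℂ) + 1)).det)) atTop
      (𝓝 (coeffVec (perPoly (Fin 3) ℂ))) := by
    rw [tendsto_pi_nhds]
    intro d
    simp only [coeffVec_apply]
    have hrw : ∀ t : ℕ, coeff d ((Ms ((t : ℂ) + 1)).det) =
        ∑ j ∈ Finset.range (e + 1), (((t : ℂ) + 1) ^ e)⁻¹ * ((t : ℂ) + 1) ^ j *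
          coeff d (weightedHomogeneousComponent w j Q) := by
      intro t
      rw [hdetMs, coeff_sum]
      refine Finset.sum_congr rfl fun j _ => ?_
      rw [coeff_C_mul]
    simp_rw [hrw]
    have htarget : coeff d (perPoly (Fin 3) ℂ) =
        ∑ j ∈ Finset.range (e + 1), (if j = e then 1 else 0) *
          coeff d (weightedHomogeneousComponent w j Q) := by
      simp only [ite_mul, one_mul, zero_mul]
      rw [Finset.sum_ite_eq', if_pos (Finset.mem_range.2 (Nat.lt_succ_self e)), htop]
    rw [htarget]
    refine tendsto_finsetSum _ fun j hj => ?_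
    refine Tendsto.mul_const _ ?_
    have hje : j ≤ e := Nat.lt_succ_iff.1 (Finset.mem_range.1 hj)
    by_cases hj' : j = e
    · subst hj'
      simp only [if_true]
      refine tendsto_const_nhds.congr' ?_
      filter_upwards [Filter.eventually_ge_atTop 0] with t _
      have hne : ((t : ℂ) + 1) ^ j ≠ 0 := pow_ne_zero _ (by
        rw [← Nat.cast_succ]; exact Nat.cast_ne_zero.2 (Nat.succ_ne_zero t))
      rw [inv_mul_cancel₀ hne]
    · rw [if_neg hj']
      -- `((t+1)^e)⁻¹ (t+1)^j = (1/(t+1))^(e-j) → 0`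
      have hk : 0 < e - j := by omega
      have h1 : Tendsto (fun t : ℕ => (1 / ((t : ℝ) + 1))) atTop (𝓝 0) :=
        tendsto_one_div_add_atTop_nhds_zero_nat
      have h2 : Tendsto (fun t : ℕ => ((1 / ((t : ℝ) + 1)) ^ (e - j) : ℝ)) atTop (𝓝 0) := by
        have := h1.pow (e - j)
        rwa [zero_pow hk.ne'] at this
      have h3 : Tendsto (fun t : ℕ => (((1 / ((t : ℝ) + 1)) ^ (e - j) : ℝ) : ℂ)) atTop (𝓝 0) := by
        have := (Complex.continuous_ofReal.tendsto 0).comp h2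
        rwa [Complex.ofReal_zero] at this
      refine h3.congr fun t => ?_
      have hne : ((t : ℂ) + 1) ≠ 0 := by
        rw [← Nat.cast_succ]; exact Nat.cast_ne_zero.2 (Nat.succ_ne_zero t)
      obtain ⟨k, hk⟩ : ∃ k, e = j + k := ⟨e - j, by omega⟩
      have hne' : (1 + (t : ℂ)) ≠ 0 := by rwa [add_comm]
      rw [hk, Nat.add_sub_cancel_left]
      push_cast
      field_simp
      rw [pow_add, mul_left_comm, ← mul_pow, one_div, inv_mul_cancel₀ hne, one_pow, mul_one]
  have hper : perPoly (Fin 3) ℂ ∈ orbitClosure (detPoly (Fin 3) ℂ) :=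
    mem_orbitClosure_of_tendsto_of_mem (fun t : ℕ => (Ms ((t : ℂ) + 1)).det) (fun t => hmem _) hlim
  have hpad : paddedPerPoly ℂ 3 3 ∈ orbitClosure (detPoly (Fin 3) ℂ) := by
    rw [paddedPerPoly_three_three]; exact hper
  have h := LMR2013_thm_1_1_1_holds 3 3 le_rfl hpad
  omega

end Border33

/-- **`per₃` is not a torus leading form of a `3 × 3` linear determinant** (registered helper form
of `Border33.not_perPoly_three_eq_top_of_det_three`; border `(3,3)` via LMR).
[cite: LandsbergManivelRessayre2013, Theorem 1.1.1] -/
theorem border33_not_perPoly_three : ∀ (M : Matrix (Fin 3) (Fin 3) (MvPolynomial (Fin 3 × Fin 3) ℂ)), (∀ i j, (M i j).IsHomogeneous 1) → ∀ (c : ℂ) (w : Fin 3 × Fin 3 → ℕ) (e : ℕ), (∀ d ∈ (MvPolynomial.C c * M.det).support, Finsupp.weight w d ≤ e) → MvPolynomial.weightedHomogeneousComponent w e (MvPolynomial.C c * M.det) = Literature.Computability.AlgebraicComplexity.perPoly (Fin 3) ℂ → False :=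
  fun M hM c w e hwe htop => Border33.not_perPoly_three_eq_top_of_det_three M hM c w e hwe htop

end

end Summit.ValiantsHypothesis.ValiantsHypothesis.Theorems.BorderApolarityToricWitnessObstructionQP
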